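import Mathlib.Algebra.Order.Chebyshev
import Literature.Analysis.FunctionSpaces.TorusClassicalNSUniqueness
import Literature.Analysis.FluidPDE.TorusClassicalHnBalance
import HarnessLib

/-!
# Energy and enstrophy identities for the difference of two classical Navier–Stokes solutions
# on the flat torus

Function-space support file (all results proved; no definitions, no named facts) for the accepted
notion `Torus.IsClassicalNSSolutionOn S ν f u p` (`TorusFluidGlue`), continuing
`TorusClassicalNSUniqueness`. For two classical solutions `(u₁, p₁)`, `(u₂, p₂)` of the
Navier–Stokes system on `[a, b] × T^d` with the same viscosity `ν` and force, the difference
`w = u₁ - u₂` solves the **difference equation** `∂ₜw = νΔw - C - ∇(p₁ - p₂)`, `div w = 0`, with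
the first-order term `C = (u₁·∇)w + (w·∇)u₂` (`….timeDerivWithin_sub_eq`; Temam 1997, Ch. III
§6.2, (6.16): `w' + νAw = h`, `h = -B(u, w) - B(w, v)`). This file supplies the two balance laws
and the coefficient bounds that every stability / uniqueness / backward-uniqueness argument for
smooth solutions runs on (`E = ∫ ‖w‖²`, `V = ‖∇w‖₂² = Torus.gradNormSq w = -∫ ⟪Δw, w⟫`):

* `Torus.IsClassicalNSSolutionOn.hasDerivWithinAt_integral_norm_sq_sub` — the energy identity
  `E' = -2νV - 2∫ ⟪(w·∇)u₂, w⟫` within `[a, b]` (the transport term `∫⟪(u₁·∇)w, w⟫` and the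
  pressure term vanish since `div u₁ = div w = 0`);
* `Torus.IsClassicalNSSolutionOn.hasDerivWithinAt_gradNormSq_sub` — the enstrophy identity
  `V' = -2ν ∫‖Δw‖² + 2∫ ⟪C, Δw⟫` within `[a, b]` (`∂ₜ` commutes with `Δ`, Green's second identity,
  and `∫⟪∇q, Δw⟫ = 0` because `Δw` is divergence free) — Temam's `½ d/dt ‖w‖_V² = (w', Aw)`;
* `Torus.norm_convect_le_of_partialDeriv_le`, `Torus.norm_convect_sq_le_of_norm_le`,
  `Torus.integral_norm_sq_convect_add_convect_le` — the bounds `‖(w·∇)u₂‖ ≤ L‖w‖`,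
  `‖(u₁·∇)w‖² ≤ |d|M² ∑ᵢ‖∂ᵢw‖²`, `‖C‖₂² ≤ 2|d|M²V + 2L²E` from `‖u₁‖ ≤ M`, `‖∂ᵢu₂‖ ≤ Cᵢ`,
  `L = ∑ᵢ Cᵢ` (Temam's (6.17), `‖h‖ ≤ k‖w‖_V`, for bounded smooth coefficients; on the compact
  `[a, b] × T^d` such bounds always exist, `Torus.IsSmoothSpaceTimeOn.exists_norm_le_of_isCompact`);
  the companion `|∫⟪(w·∇)u₂, w⟫| ≤ L E` is `Torus.abs_integral_inner_convect_le` of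
  `TorusLinearisedNSEnergy` (the linearised twin of this file; not imported here).

The consumer is `TorusClassicalNSBackwardUniqueness` (log-convexity). What is NOT here: the
`Hⁿ` balances of the difference for `n ≥ 2`, and estimates with unbounded (`L^p_t`) coefficients.

## Mathlib / tree search

Tree (reused): `….timeDerivWithin_sub_eq`, `Torus.laplacian_sub`,
`Torus.integral_inner_convect_self_right_eq_zero` (`TorusClassicalNSUniqueness`),
`Torus.integral_inner_laplacian_self_eq_neg_gradNormSq`, `Torus.IsDivFree.laplacian_of_isSmooth`
(`FluidPDE/TorusClassicalH(1|n)Balance`), `Torus.timeDerivWithin_laplacian_comm`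
(`TorusInverseLaplacianCalculus`), `Torus.integral_inner_laplacian_comm`,
`Torus.integral_inner_gradient_eq_zero_of_isDivFree`, `Torus.fderiv_apply_eq_sum_partialDeriv`,
`Torus.IsSmoothSpaceTimeOn.hasDerivWithinAt_integral/.timeDerivWithin_inner/.hasDerivWithinAt_slice`
(`TorusCalculusProofs`, `TorusSpaceTime`); the pattern is `….energy_deriv_sub_le`
(`TorusClassicalNSUniqueness`) and `….hasDerivWithinAt_half_gradNormSq` (`TorusClassicalH1Balance`),
which treat `E` for the difference and `V` for a single solution respectively; searched
`gradNormSq_sub`, `norm_sq_sub` with `hasDerivWithinAt` on the torus side: none. Mathlib: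
`sq_sum_le_card_mul_sum_sq`, `HasDerivWithinAt.norm_sq/.congr_of_mem/.congr_deriv`,
`norm_add_le`.

## References

* R. Temam, *Infinite-Dimensional Dynamical Systems in Mechanics and Physics*, 2nd ed., Springer
  1997, Ch. III §6.1 (proofs of Lemmas 6.1, 6.2) and §6.2 ((6.16)–(6.17)). [Temam1997]
* P. Constantin, C. Foias, *Navier–Stokes Equations*, Univ. Chicago Press 1988, Ch. 13, (13.3)
  (the linearised / difference equation `v' + νAv + B(u, v) + B(v, u) = 0` and its energy
  estimates). [ConstantinFoiasNSE1988]
-/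

open MeasureTheory Set Filter
open scoped InnerProductSpace ContDiff Topology

noncomputable section

namespace Literature.Analysis.FunctionSpaces

namespace Torus

variable {d : Type*} [Fintype d] [DecidableEq d]

/-! ## Pointwise and integral bounds for the first-order terms -/

section Bounds

/-- `‖(w·∇)u (x)‖ ≤ (∑ᵢ Cᵢ) ‖w(x)‖` when `‖∂ᵢu‖ ≤ Cᵢ` (`(w·∇)u = ∑ᵢ wᵢ ∂ᵢu`; the pointwise step
of `Torus.abs_integral_inner_convect_le` of `TorusLinearisedNSEnergy`). [folklore] -/
theorem norm_convect_le_of_partialDeriv_le {w u : UnitAddTorus d → EuclideanSpace ℝ d}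
    (hu : IsSmooth u) {C : d → ℝ} (hC : ∀ i x, ‖partialDeriv i u x‖ ≤ C i) (x : UnitAddTorus d) :
    ‖convect w u x‖ ≤ (∑ i, C i) * ‖w x‖ := by
  have hconv : convect w u x = ∑ i, w x i • partialDeriv i u x :=
    fderiv_apply_eq_sum_partialDeriv (hu.isContDiff (by simp)) x (w x)
  rw [hconv, Finset.sum_mul]
  refine (norm_sum_le _ _).trans (Finset.sum_le_sum fun i _ => ?_)
  rw [norm_smul]
  calc ‖w x i‖ * ‖partialDeriv i u x‖ ≤ ‖w x‖ * C i :=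
        mul_le_mul (PiLp.norm_apply_le (w x) i) (hC i x) (norm_nonneg _) (norm_nonneg _)
    _ = C i * ‖w x‖ := mul_comm _ _

/-- `‖(u·∇)w (x)‖² ≤ |d| M² ∑ᵢ ‖∂ᵢw(x)‖²` when `‖u‖ ≤ M` (`(u·∇)w = ∑ᵢ uᵢ ∂ᵢw` and Cauchy–Schwarz
`(∑ᵢ aᵢ)² ≤ |d| ∑ᵢ aᵢ²`). [folklore] -/
theorem norm_convect_sq_le_of_norm_le {u w : UnitAddTorus d → EuclideanSpace ℝ d}
    (hw : IsSmooth w) {M : ℝ} (hM : ∀ x, ‖u x‖ ≤ M) (x : UnitAddTorus d) :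
    ‖convect u w x‖ ^ 2 ≤ Fintype.card d * M ^ 2 * ∑ i, ‖partialDeriv i w x‖ ^ 2 := by
  have hM0 : 0 ≤ M := (norm_nonneg _).trans (hM x)
  have hconv : convect u w x = ∑ i, u x i • partialDeriv i w x :=
    fderiv_apply_eq_sum_partialDeriv (hw.isContDiff (by simp)) x (u x)
  have h1 : ‖convect u w x‖ ≤ M * ∑ i, ‖partialDeriv i w x‖ := by
    rw [hconv, Finset.mul_sum]
    refine (norm_sum_le _ _).trans (Finset.sum_le_sum fun i _ => ?_)
    rw [norm_smul]
    exact mul_le_mul_of_nonneg_right ((PiLp.norm_apply_le (u x) i).trans (hM x)) (norm_nonneg _)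
  have h2 : (∑ i, ‖partialDeriv i w x‖) ^ 2 ≤ Fintype.card d * ∑ i, ‖partialDeriv i w x‖ ^ 2 := by
    have h := sq_sum_le_card_mul_sum_sq (s := Finset.univ) (f := fun i => ‖partialDeriv i w x‖)
    rwa [Finset.card_univ] at h
  calc ‖convect u w x‖ ^ 2 ≤ (M * ∑ i, ‖partialDeriv i w x‖) ^ 2 :=
        pow_le_pow_left₀ (norm_nonneg _) h1 2
    _ = M ^ 2 * (∑ i, ‖partialDeriv i w x‖) ^ 2 := by ring
    _ ≤ M ^ 2 * (Fintype.card d * ∑ i, ‖partialDeriv i w x‖ ^ 2) :=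
        mul_le_mul_of_nonneg_left h2 (sq_nonneg _)
    _ = Fintype.card d * M ^ 2 * ∑ i, ‖partialDeriv i w x‖ ^ 2 := by ring

/-- **`L²` bound of the first-order term of the difference equation**: for smooth fields with
`‖u₁‖ ≤ M` and `‖∂ᵢu₂‖ ≤ Cᵢ` on `T^d`,
`∫ ‖(u₁·∇)w + (w·∇)u₂‖² ≤ 2|d|M² ‖∇w‖₂² + 2(∑ᵢCᵢ)² ∫ ‖w‖²` — the torus version of Temam's
(6.17) `‖B(u, w) + B(w, v)‖ ≤ k ‖w‖_V` for bounded smooth coefficients. [cite: Temam1997, Ch. III §6.2 (6.16)–(6.17)] -/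
theorem integral_norm_sq_convect_add_convect_le {u₁ u₂ w : UnitAddTorus d → EuclideanSpace ℝ d}
    (hu₂ : IsSmooth u₂) (hw : IsSmooth w) {M : ℝ} (hM : ∀ x, ‖u₁ x‖ ≤ M)
    {C : d → ℝ} (hC : ∀ i x, ‖partialDeriv i u₂ x‖ ≤ C i) :
    ∫ x, ‖convect u₁ w x + convect w u₂ x‖ ^ 2 ≤
      2 * (Fintype.card d * M ^ 2) * gradNormSq w + 2 * (∑ i, C i) ^ 2 * ∫ x, ‖w x‖ ^ 2 := by
  set L : ℝ := ∑ i, C i with hL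
  have hpt : ∀ x, ‖convect u₁ w x + convect w u₂ x‖ ^ 2 ≤
      2 * (Fintype.card d * M ^ 2) * (∑ i, ‖partialDeriv i w x‖ ^ 2) + 2 * L ^ 2 * ‖w x‖ ^ 2 := by
    intro x
    have h1 := norm_convect_sq_le_of_norm_le (u := u₁) hw hM x
    have h2 : ‖convect w u₂ x‖ ^ 2 ≤ L ^ 2 * ‖w x‖ ^ 2 := by
      have h := norm_convect_le_of_partialDeriv_le (w := w) hu₂ hC x
      calc ‖convect w u₂ x‖ ^ 2 ≤ (L * ‖w x‖) ^ 2 := pow_le_pow_left₀ (norm_nonneg _) h 2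
        _ = L ^ 2 * ‖w x‖ ^ 2 := by ring
    have h3 : ‖convect u₁ w x + convect w u₂ x‖ ^ 2 ≤
        2 * ‖convect u₁ w x‖ ^ 2 + 2 * ‖convect w u₂ x‖ ^ 2 := by
      have h := norm_add_le (convect u₁ w x) (convect w u₂ x)
      nlinarith [norm_nonneg (convect u₁ w x + convect w u₂ x), norm_nonneg (convect u₁ w x),
        norm_nonneg (convect w u₂ x), sq_nonneg (‖convect u₁ w x‖ - ‖convect w u₂ x‖)]
    linarith
  have hiD : Integrable (fun x => ∑ i, ‖partialDeriv i w x‖ ^ 2) volume :=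
    integrable_finsetSum _ fun i _ => (hw.partialDeriv i).norm_sq.integrable
  have hiR : Integrable (fun x => 2 * (Fintype.card d * M ^ 2) * (∑ i, ‖partialDeriv i w x‖ ^ 2) +
      2 * L ^ 2 * ‖w x‖ ^ 2) volume :=
    (hiD.const_mul _).add (hw.norm_sq.integrable.const_mul _)
  calc ∫ x, ‖convect u₁ w x + convect w u₂ x‖ ^ 2
      ≤ ∫ x, (2 * (Fintype.card d * M ^ 2) * (∑ i, ‖partialDeriv i w x‖ ^ 2) +
          2 * L ^ 2 * ‖w x‖ ^ 2) :=
        integral_mono_of_nonneg (Eventually.of_forall fun x => sq_nonneg _) hiR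
          (Eventually.of_forall hpt)
    _ = 2 * (Fintype.card d * M ^ 2) * gradNormSq w + 2 * L ^ 2 * ∫ x, ‖w x‖ ^ 2 := by
        rw [integral_add (hiD.const_mul _) (hw.norm_sq.integrable.const_mul _), integral_const_mul,
          integral_const_mul, gradNormSq]

end Bounds

/-! ## The energy and enstrophy identities for the difference of two solutions -/

section Difference

variable {a b ν : ℝ} {f u₁ u₂ : ℝ → UnitAddTorus d → EuclideanSpace ℝ d}
  {p₁ p₂ : ℝ → UnitAddTorus d → ℝ}

/-- **Energy identity for the difference.** For two classical solutions on `[a, b] × T^d`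
(`a < b`, same viscosity and force), `w = u₁ - u₂` satisfies, within `[a, b]`,
`d/dt ∫ ‖w‖² = -2ν ‖∇w‖₂² - 2∫ ⟪(w·∇)u₂, w⟫`: pair `∂ₜw = νΔw - (u₁·∇)w - (w·∇)u₂ - ∇q` with
`w`; `∫⟪Δw, w⟫ = -‖∇w‖₂²`, and the transport and pressure terms vanish since
`div u₁ = div w = 0` (Temam 1997, Ch. III §6.1, proof of Lemma 6.2; Majda–Bertozzi 2002,
Prop. 3.1). [cite: Temam1997, Ch. III §6.1 Lemma 6.2 (6.14)] -/
theorem IsClassicalNSSolutionOn.hasDerivWithinAt_integral_norm_sq_sub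
    (h₁ : IsClassicalNSSolutionOn (Icc a b) ν f u₁ p₁)
    (h₂ : IsClassicalNSSolutionOn (Icc a b) ν f u₂ p₂) (hab : a < b) {t : ℝ} (ht : t ∈ Icc a b) :
    HasDerivWithinAt (fun s => ∫ x, ‖u₁ s x - u₂ s x‖ ^ 2)
      (-(2 * ν * gradNormSq (fun y => u₁ t y - u₂ t y)) -
        2 * ∫ x, ⟪convect (fun y => u₁ t y - u₂ t y) (u₂ t) x, u₁ t x - u₂ t x⟫_ℝ)
      (Icc a b) t := by
  have hU : UniqueDiffOn ℝ (Icc a b) := uniqueDiffOn_Icc hab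
  set w : ℝ → UnitAddTorus d → EuclideanSpace ℝ d := fun s y => u₁ s y - u₂ s y with hw_def
  have hw : IsSmoothSpaceTimeOn (Icc a b) w := h₁.smooth_velocity.sub h₂.smooth_velocity
  have hwt : IsSmooth (w t) := hw.isSmooth_slice ht
  have hu₁t : IsSmooth (u₁ t) := h₁.smooth_velocity.isSmooth_slice ht
  have hu₂t : IsSmooth (u₂ t) := h₂.smooth_velocity.isSmooth_slice ht
  have hqt : IsSmooth (fun y => p₁ t y - p₂ t y) :=
    (h₁.smooth_pressure.isSmooth_slice ht).sub (h₂.smooth_pressure.isSmooth_slice ht)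
  have hdivw : IsDivFree (w t) := by
    intro x
    have hw' : w t = u₁ t - u₂ t := rfl
    rw [hw', divergence_sub (hu₁t.isContDiff (by simp)) (hu₂t.isContDiff (by simp)),
      h₁.divFree t ht x, h₂.divFree t ht x, sub_zero]
  have hlapw : ∀ x, laplacian (u₁ t) x - laplacian (u₂ t) x = laplacian (w t) x := by
    intro x
    have hw' : w t = u₁ t - u₂ t := rfl
    rw [hw', laplacian_sub hu₁t hu₂t, Pi.sub_apply]
  have hderiv : ∀ x, timeDerivWithin (Icc a b) w t x =
      ν • laplacian (w t) x - (convect (u₁ t) (w t) x + convect (w t) (u₂ t) x) -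
        gradient (fun y => p₁ t y - p₂ t y) x := by
    intro x
    rw [← hlapw x]
    exact h₁.timeDerivWithin_sub_eq h₂ hab ht x
  -- differentiate under the integral sign; `∂ₜ‖w‖² = 2⟪∂ₜw, w⟫`
  have hφ : IsSmoothSpaceTimeOn (Icc a b) (fun s x => ‖w s x‖ ^ 2) := hw.norm_sq ℝ
  have hE := hφ.hasDerivWithinAt_integral (convex_Icc a b) ht
  have hpt : ∀ x, timeDerivWithin (Icc a b) (fun s x => ‖w s x‖ ^ 2) t x =
      2 * ⟪timeDerivWithin (Icc a b) w t x, w t x⟫_ℝ := by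
    intro x
    have h1 := ((hw.hasDerivWithinAt_slice ht x).norm_sq).derivWithin (hU t ht)
    change derivWithin (fun τ => ‖w τ x‖ ^ 2) (Icc a b) t = _
    rw [h1, real_inner_comm]
  have hi0 : Integrable (fun x => ⟪laplacian (w t) x, w t x⟫_ℝ) volume :=
    (hwt.laplacian.inner hwt).integrable
  have hi1 : Integrable (fun x => ⟪convect (u₁ t) (w t) x, w t x⟫_ℝ) volume :=
    ((hu₁t.convect hwt).inner hwt).integrable
  have hi2 : Integrable (fun x => ⟪convect (w t) (u₂ t) x, w t x⟫_ℝ) volume :=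
    ((hwt.convect hu₂t).inner hwt).integrable
  have hi3 : Integrable (fun x => ⟪gradient (fun y => p₁ t y - p₂ t y) x, w t x⟫_ℝ) volume :=
    (hqt.gradient.inner hwt).integrable
  have hE't : ∫ x, timeDerivWithin (Icc a b) (fun s x => ‖w s x‖ ^ 2) t x =
      -(2 * ν * gradNormSq (w t)) - 2 * ∫ x, ⟪convect (w t) (u₂ t) x, w t x⟫_ℝ := by
    have hi12 : Integrable (fun x => ⟪convect (u₁ t) (w t) x, w t x⟫_ℝ +
        ⟪convect (w t) (u₂ t) x, w t x⟫_ℝ) volume := hi1.add hi2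
    have hiν : Integrable (fun x => ν * ⟪laplacian (w t) x, w t x⟫_ℝ) volume := hi0.const_mul ν
    have hiF : Integrable (fun x => ν * ⟪laplacian (w t) x, w t x⟫_ℝ -
        (⟪convect (u₁ t) (w t) x, w t x⟫_ℝ + ⟪convect (w t) (u₂ t) x, w t x⟫_ℝ)) volume :=
      hiν.sub hi12
    simp_rw [hpt, hderiv, inner_sub_left, inner_add_left, real_inner_smul_left]
    rw [integral_const_mul, integral_sub hiF hi3, integral_sub hiν hi12,
      integral_const_mul, integral_add hi1 hi2,
      integral_inner_convect_self_right_eq_zero hu₁t (h₁.divFree t ht) hwt,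
      integral_inner_gradient_eq_zero_of_isDivFree hwt hqt hdivw,
      Literature.Analysis.FluidPDE.Torus.integral_inner_laplacian_self_eq_neg_gradNormSq hwt]
    ring
  rw [hE't] at hE
  exact hE

/-- **Enstrophy identity for the difference.** For two classical solutions on `[a, b] × T^d`
(`a < b`, same viscosity and force), `w = u₁ - u₂` satisfies, within `[a, b]`,
`d/dt ‖∇w‖₂² = -2ν ∫ ‖Δw‖² + 2∫ ⟪(u₁·∇)w + (w·∇)u₂, Δw⟫`: `‖∇w‖₂² = -∫ ⟪Δw, w⟫`,
`∂ₜ` commutes with `Δ`, Green's second identity gives `d/dt ∫⟪Δw, w⟫ = 2∫⟪∂ₜw, Δw⟫`, and the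
pressure term `∫⟪∇q, Δw⟫` vanishes because `Δw` is divergence free (Temam 1997, Ch. III §6.1,
proof of Lemma 6.1: `½ d/dt ‖w‖²_V = ((w', w)) = (w', Aw)`). [cite: Temam1997, Ch. III §6.1 Lemma 6.1] -/
theorem IsClassicalNSSolutionOn.hasDerivWithinAt_gradNormSq_sub
    (h₁ : IsClassicalNSSolutionOn (Icc a b) ν f u₁ p₁)
    (h₂ : IsClassicalNSSolutionOn (Icc a b) ν f u₂ p₂) (hab : a < b) {t : ℝ} (ht : t ∈ Icc a b) :
    HasDerivWithinAt (fun s => gradNormSq (fun y => u₁ s y - u₂ s y))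
      (-(2 * ν * ∫ x, ‖laplacian (fun y => u₁ t y - u₂ t y) x‖ ^ 2) +
        2 * ∫ x, ⟪convect (u₁ t) (fun y => u₁ t y - u₂ t y) x +
          convect (fun y => u₁ t y - u₂ t y) (u₂ t) x, laplacian (fun y => u₁ t y - u₂ t y) x⟫_ℝ)
      (Icc a b) t := by
  have hU : UniqueDiffOn ℝ (Icc a b) := uniqueDiffOn_Icc hab
  set w : ℝ → UnitAddTorus d → EuclideanSpace ℝ d := fun s y => u₁ s y - u₂ s y with hw_def
  have hw : IsSmoothSpaceTimeOn (Icc a b) w := h₁.smooth_velocity.sub h₂.smooth_velocity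
  have hwt : IsSmooth (w t) := hw.isSmooth_slice ht
  have hu₁t : IsSmooth (u₁ t) := h₁.smooth_velocity.isSmooth_slice ht
  have hu₂t : IsSmooth (u₂ t) := h₂.smooth_velocity.isSmooth_slice ht
  have hqt : IsSmooth (fun y => p₁ t y - p₂ t y) :=
    (h₁.smooth_pressure.isSmooth_slice ht).sub (h₂.smooth_pressure.isSmooth_slice ht)
  have hA : IsSmooth (timeDerivWithin (Icc a b) w t) := hw.isSmooth_timeDerivWithin hU ht
  have hΔ : IsSmooth (laplacian (w t)) := hwt.laplacian
  have hdivw : IsDivFree (w t) := by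
    intro x
    have hw' : w t = u₁ t - u₂ t := rfl
    rw [hw', divergence_sub (hu₁t.isContDiff (by simp)) (hu₂t.isContDiff (by simp)),
      h₁.divFree t ht x, h₂.divFree t ht x, sub_zero]
  have hlapw : ∀ x, laplacian (u₁ t) x - laplacian (u₂ t) x = laplacian (w t) x := by
    intro x
    have hw' : w t = u₁ t - u₂ t := rfl
    rw [hw', laplacian_sub hu₁t hu₂t, Pi.sub_apply]
  have hderiv : ∀ x, timeDerivWithin (Icc a b) w t x =
      ν • laplacian (w t) x - (convect (u₁ t) (w t) x + convect (w t) (u₂ t) x) -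
        gradient (fun y => p₁ t y - p₂ t y) x := by
    intro x
    rw [← hlapw x]
    exact h₁.timeDerivWithin_sub_eq h₂ hab ht x
  -- Step 1: `s ↦ -∫ ⟪Δ(w s), w s⟫` is differentiable within `[a, b]`
  have hφ : IsSmoothSpaceTimeOn (Icc a b) (fun s x => ⟪laplacian (w s) x, w s x⟫_ℝ) :=
    (hw.laplacian hU).inner hw
  have hI := (hφ.hasDerivWithinAt_integral (convex_Icc a b) ht).neg
  -- Step 2: `∂ₜ⟪Δw, w⟫ = ⟪Δw, ∂ₜw⟫ + ⟪Δ∂ₜw, w⟫`, whence `∫ ∂ₜ⟪Δw, w⟫ = 2∫ ⟪∂ₜw, Δw⟫` (Green)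
  have hpt : ∀ x, timeDerivWithin (Icc a b) (fun s x => ⟪laplacian (w s) x, w s x⟫_ℝ) t x =
      ⟪laplacian (w t) x, timeDerivWithin (Icc a b) w t x⟫_ℝ +
        ⟪laplacian (timeDerivWithin (Icc a b) w t) x, w t x⟫_ℝ := by
    intro x
    rw [(hw.laplacian hU).timeDerivWithin_inner hw hU ht x,
      timeDerivWithin_laplacian_comm hab hw ht x]
  have hE' : -(∫ x, timeDerivWithin (Icc a b) (fun s x => ⟪laplacian (w s) x, w s x⟫_ℝ) t x) =
      -(2 * ∫ x, ⟪timeDerivWithin (Icc a b) w t x, laplacian (w t) x⟫_ℝ) := by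
    simp_rw [hpt]
    rw [integral_add (hΔ.inner hA).integrable (hA.laplacian.inner hwt).integrable,
      integral_inner_laplacian_comm hA hwt]
    have hc : ∫ x, ⟪laplacian (w t) x, timeDerivWithin (Icc a b) w t x⟫_ℝ =
        ∫ x, ⟪timeDerivWithin (Icc a b) w t x, laplacian (w t) x⟫_ℝ :=
      integral_congr_ae (ae_of_all _ fun x => real_inner_comm _ _)
    rw [hc]
    ring
  rw [hE'] at hI
  -- Step 3: insert the equation; the pressure term drops out
  have iL : Integrable (fun x => ⟪ν • laplacian (w t) x, laplacian (w t) x⟫_ℝ) volume :=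
    ((hΔ.smul ν).inner hΔ).integrable
  have iC : Integrable (fun x => ⟪convect (u₁ t) (w t) x + convect (w t) (u₂ t) x,
      laplacian (w t) x⟫_ℝ) volume :=
    (((hu₁t.convect hwt).add (hwt.convect hu₂t)).inner hΔ).integrable
  have iG : Integrable (fun x => ⟪gradient (fun y => p₁ t y - p₂ t y) x, laplacian (w t) x⟫_ℝ)
      volume := (hqt.gradient.inner hΔ).integrable
  have hsplit : ∫ x, ⟪timeDerivWithin (Icc a b) w t x, laplacian (w t) x⟫_ℝ =
      (∫ x, ⟪ν • laplacian (w t) x, laplacian (w t) x⟫_ℝ) -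
        (∫ x, ⟪convect (u₁ t) (w t) x + convect (w t) (u₂ t) x, laplacian (w t) x⟫_ℝ) -
        ∫ x, ⟪gradient (fun y => p₁ t y - p₂ t y) x, laplacian (w t) x⟫_ℝ := by
    have iLC : Integrable (fun x => ⟪ν • laplacian (w t) x, laplacian (w t) x⟫_ℝ -
        ⟪convect (u₁ t) (w t) x + convect (w t) (u₂ t) x, laplacian (w t) x⟫_ℝ) volume :=
      iL.sub iC
    simp_rw [hderiv, inner_sub_left]
    rw [integral_sub iLC iG, integral_sub iL iC]
  have hvisc : ∫ x, ⟪ν • laplacian (w t) x, laplacian (w t) x⟫_ℝ =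
      ν * ∫ x, ‖laplacian (w t) x‖ ^ 2 := by
    rw [← integral_const_mul]
    refine integral_congr_ae (ae_of_all _ fun x => ?_)
    simp only [real_inner_smul_left, real_inner_self_eq_norm_sq]
  have hpres : ∫ x, ⟪gradient (fun y => p₁ t y - p₂ t y) x, laplacian (w t) x⟫_ℝ = 0 :=
    integral_inner_gradient_eq_zero_of_isDivFree hΔ hqt
      (Literature.Analysis.FluidPDE.Torus.IsDivFree.laplacian_of_isSmooth hwt hdivw)
  rw [hsplit, hvisc, hpres, sub_zero] at hI
  -- Step 4: `‖∇w‖₂² = -∫ ⟪Δw, w⟫` on `[a, b]`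
  refine (hI.congr_of_mem (fun s hs => ?_) ht).congr_deriv (by ring)
  have hws : IsSmooth (w s) := hw.isSmooth_slice hs
  have h := Literature.Analysis.FluidPDE.Torus.integral_inner_laplacian_self_eq_neg_gradNormSq hws
  change gradNormSq (w s) = -∫ x, ⟪laplacian (w s) x, w s x⟫_ℝ
  rw [h, neg_neg]

end Difference

end Torus

end Literature.Analysis.FunctionSpaces
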